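import Mathlib
import Summits.Ventures.HodgeRepro.Tier4.Target
import Summits.Ventures.HodgeRepro.Tier4.Line3.Defs
import Summits.Ventures.HodgeRepro.Tier4.Line3.Majorant

/-!
# Tier4/Line3/SylvesterTransfer — the `J`-form of the ball coordinates is the hermitian form at `τ₀` (rung for L3.4 / L3.5)

Blind re-derivation cell `pub-hodge-repro`, Tier 4 «PROVE THE STEP» (README §9–§10), LINE L3, seat t4-L2-p3 on L3.5
`term_dominated` (lead S12234).

The ball coordinates of a vector `x ∈ V(E′)` are `y(x) = C⁻¹ τ₀(x)` (`T4Data.ballCoord`), with `C` the Sylvester matrix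
of the signature-`(2,1)` form `H_{τ₀}`: `Cᴴ H_{τ₀} C = ±J` (`IsSylvester`, `X.hC`).  Hence the indefinite form of the
ball coordinates is the hermitian form transported by `τ₀`:

  `(y(x), y(x'))_J = star (y x) ⬝ᵥ (J *ᵥ y x') = ± τ₀ ⟨x, x'⟩_H`

(`ballCoord_J_eq_or`), using `conj (τ₀ x) = τ₀ (c′ x)` for the complex conjugation of the CM field
(`IsCMField.complexEmbedding_complexConj`).  Consequently `‖(y x, y x')_J‖ = ‖τ₀ ⟨x, x'⟩_H‖` (`norm_ballCoord_J`), which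
is how a Gram entry LARGE at `τ₀` (the archimedean-size rung, `OffMainOrbit.exists_gram_dev_size`) feeds the majorant
estimate R4 (`Majorant.rung_gaussian_small`): `gaussian_small_of_norm_tau_ge`.

Nothing here asserts anything about the truth of (P); HC_CM is NOT proved by anyone in this repository.
-/

set_option autoImplicit false

noncomputable section

namespace Summit.Ventures.HodgeRepro.Tier4.Line3

open Matrix NumberField
open scoped ComplexConjugate

namespace T4Data

variable (X : T4Data)

/-- `conj (τ₀ t) = τ₀ (c′ t)`: the embedding `τ₀` intertwines `c′` with complex conjugation. -/
theorem conj_tau (t : X.E) : conj (X.τ₀ t) = X.τ₀ (X.c t) :=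
  (IsCMField.complexEmbedding_complexConj X.E X.τ₀ t).symm

/-- `Cᴴ H_{τ₀} C = ±J` transposed: `C⁻¹ᴴ J C⁻¹ = ±H_{τ₀}`. -/
theorem inv_conjTranspose_J_inv :
    X.C⁻¹ᴴ * J * X.C⁻¹ = X.H.map X.τ₀ ∨ X.C⁻¹ᴴ * J * X.C⁻¹ = -(X.H.map X.τ₀) := by
  obtain ⟨hCu, hC⟩ := X.hC
  have hCd : IsUnit X.C.det := (Matrix.isUnit_iff_isUnit_det X.C).mp hCu
  have h1 : X.C⁻¹ᴴ * X.Cᴴ = 1 := by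
    rw [← Matrix.conjTranspose_mul, Matrix.mul_nonsing_inv X.C hCd, Matrix.conjTranspose_one]
  have h2 : X.C * X.C⁻¹ = 1 := Matrix.mul_nonsing_inv X.C hCd
  have key : ∀ M : Matrix (Fin 3) (Fin 3) ℂ, X.Cᴴ * X.H.map X.τ₀ * X.C = M →
      X.C⁻¹ᴴ * M * X.C⁻¹ = X.H.map X.τ₀ := by
    intro M hM
    rw [← hM]
    calc X.C⁻¹ᴴ * (X.Cᴴ * X.H.map X.τ₀ * X.C) * X.C⁻¹
        = (X.C⁻¹ᴴ * X.Cᴴ) * X.H.map X.τ₀ * (X.C * X.C⁻¹) := by simp only [Matrix.mul_assoc]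
      _ = X.H.map X.τ₀ := by rw [h1, h2, Matrix.one_mul, Matrix.mul_one]
  rcases hC with hJ | hJ
  · exact Or.inl (key J hJ)
  · right
    have := key (-J) hJ
    rw [Matrix.mul_neg, Matrix.neg_mul] at this
    rw [← this, neg_neg]

/-- **THE SYLVESTER TRANSFER**: `(y x, y x')_J = ± τ₀ ⟨x, x'⟩_H` for the ball coordinates `y = ballCoord`. -/
theorem ballCoord_J_eq_or (x x' : Fin 3 → X.E) :
    star (X.ballCoord x) ⬝ᵥ (J *ᵥ X.ballCoord x') = X.τ₀ (hform X.c X.H x x') ∨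
    star (X.ballCoord x) ⬝ᵥ (J *ᵥ X.ballCoord x') = -X.τ₀ (hform X.c X.H x x') := by
  -- the `τ₀`-images of the vectors
  set v : Fin 3 → ℂ := fun i => X.τ₀ (x i) with hv
  set w : Fin 3 → ℂ := fun i => X.τ₀ (x' i) with hw
  have hmat : star (X.ballCoord x) ⬝ᵥ (J *ᵥ X.ballCoord x') =
      star v ⬝ᵥ ((X.C⁻¹ᴴ * J * X.C⁻¹) *ᵥ w) := by
    simp only [ballCoord]
    rw [Matrix.star_mulVec, Matrix.mulVec_mulVec, ← Matrix.dotProduct_mulVec, Matrix.mulVec_mulVec,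
      Matrix.mul_assoc]
  -- `star v ⬝ᵥ (H_{τ₀} *ᵥ w) = τ₀ ⟨x, x'⟩_H`
  have hH : star v ⬝ᵥ (X.H.map X.τ₀ *ᵥ w) = X.τ₀ (hform X.c X.H x x') := by
    simp only [hform, dotProduct, Matrix.mulVec, Matrix.map_apply, map_sum, map_mul, Pi.star_apply, hv, hw,
      Complex.star_def, X.conj_tau]
  rcases X.inv_conjTranspose_J_inv with h | h
  · left
    rw [hmat, h, hH]
  · right
    rw [hmat, h, Matrix.neg_mulVec, dotProduct_neg, hH]

/-- `‖(y x, y x')_J‖ = ‖τ₀ ⟨x, x'⟩_H‖`. -/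
theorem norm_ballCoord_J (x x' : Fin 3 → X.E) :
    ‖star (X.ballCoord x) ⬝ᵥ (J *ᵥ X.ballCoord x')‖ = ‖X.τ₀ (hform X.c X.H x x')‖ := by
  rcases X.ballCoord_J_eq_or x x' with h | h
  · rw [h]
  · rw [h, norm_neg]

/-- **R4 THROUGH THE SYLVESTER TRANSFER.** If the Gram entry `⟨x, x'⟩_H` has `τ₀`-size `≥ R`, the product of the
kernel's Gaussians at `y x`, `y x'` is `≤ e^{−2πR}` at EVERY point of the ball. -/
theorem gaussian_small_of_norm_tau_ge (x x' : Fin 3 → X.E) (z : Fin 2 → ℂ) (hz : z ∈ ball) (R : ℝ)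
    (hR : R ≤ ‖X.τ₀ (hform X.c X.H x x')‖) :
    Real.exp (-Real.pi * maj (X.ballCoord x) z) * Real.exp (-Real.pi * maj (X.ballCoord x') z) ≤
      Real.exp (-(2 * Real.pi * R)) :=
  rung_gaussian_small (X.ballCoord x) (X.ballCoord x') z hz R (by rw [X.norm_ballCoord_J]; exact hR)

/-- **THE GRAM DEVIATION AT `τ₀` LOWERS THE GRAM ENTRY.** `‖τ₀ ⟨x_i, x_j⟩‖ ≥ ‖τ₀ α‖ − ‖τ₀ ⟨xm_i, xm_j⟩‖` for the deviation
`α = ⟨x_i, x_j⟩ − ⟨xm_i, xm_j⟩`. -/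
theorem norm_tau_ge_of_dev (a b : X.E) : ‖X.τ₀ (a - b)‖ - ‖X.τ₀ b‖ ≤ ‖X.τ₀ a‖ := by
  have h := norm_sub_le (X.τ₀ a) (X.τ₀ b)
  rw [← map_sub] at h
  linarith

end T4Data

end Summit.Ventures.HodgeRepro.Tier4.Line3

end
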